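import Summits.BirchSwinnertonDyer.BirchSwinnertonDyer.Theorems.ClassRecordThreeCornerAtThreeUpperModEightKernelCha
import Summits.BirchSwinnertonDyer.BirchSwinnertonDyer.Theorems.ClassRecordThreeCornerAtThreeFactsDischarged
import Summits.BirchSwinnertonDyer.BirchSwinnertonDyer.Theorems.SchneiderFreeAdditiveX3PoitouTateReciprocitySumHolds
import Summits.BirchSwinnertonDyer.BirchSwinnertonDyer.Theorems.SchneiderFreeAdditiveX3PoitouTateSelmerDualityHolds
import HarnessLib

/-!
# Routes `ClassRecordThree` ∕ `KolyvaginRoadThree` (rung K2@3), crux `CornerAtThreeW` (item stmt-BirchSwinnertonDyer-21420; 19111 aside),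
# line `Cruxes/CornerAtThreeW/Lines/inert.lean`: KERNEL CERTIFICATE that revision r12 (lane B g12, c9d1e09a804065fa) is a PURE RE-CUT of the
# REGISTERED r11 (033c13e6a50c97d3) by THEOREMS OF THE TREE — the r11 texts of the two reshaped citable stubs FROM the r12 texts, and back
# (cell `bsd-stepL`, seat `bsd-stepL-corner3-p2` g12 = WIDTH-LEVER lane B; `--supports stmt-BirchSwinnertonDyer-21420 --as helper`)

WHY. r12 removes SIX cited conjuncts from the line because each is now a theorem of the tree: conjunct 2 of `stub_upper3_monoNamedFacts`
(`∀ K n, (LocalInvariants.canonical K n).SelmerComplement`, Howard 2004 Thm. 2.1.11 ∕ Milne I Thm. 4.10(b) `⊇` for THE canonical invariant maps —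
`SchneiderFreeAdditiveX3.PoitouTateReduction.selmerComplement_canonical_holds`, cell bsd-schneider door-c4 g18, p626891) and five conjuncts of
`stub_cornerFacts3` (Kato 2004 §12.2 (12.2.1) `Kato2004.nonempty_iwasawaH1Data`, Darmon 2004 Thm. 3.7 `heegnerPointOfConductor_one_galoisConj`,
Darmon 2004 Thm. 3.6 `phi_heegnerTau_mem_singularModuliField`, Barrios et al. 2025 Thm. 5.1 `localTamagawaNumber_quadraticTwist_two_mem_of_goodReduction`
— the four `_holds` companions recorded by mult-p3 g5's `…CornerAtThreeFactsDischarged` — and Poitou–Tate duality for Selmer structures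
`poitouTate_selmerStructure_duality` — `SchneiderFreeAdditiveX3.PoitouTateReduction.poitouTate_selmerStructure_duality_holds`, p624636). This file
states the registered r11 texts and the r12 texts of the two stubs VERBATIM as hypotheses ∕ conclusions and proves the four implications, so the
registry move r11 → r12 is certified mechanically: `monoNamedFacts_r11_of_r12`, `cornerFacts3_r11_of_r12` (r12 ⟹ r11: the removed conjuncts are
supplied by the tree theorems) and the projections `monoNamedFacts_r12_of_r11`, `cornerFacts3_r12_of_r11`. The other five stubs of the line
(`stub_cornerStepL3`, `stub_upper3_inertDisplay`, `stub_upper3_residualMulti`, `stub_cornerTwistLower3`, `stub_cornerTwistMuAn3`) are byte-identical in r11 and r12.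

HONEST FRAMING: bookkeeping theorems about conjunctions of NAMED, published, typed, unformalised `def … : Prop` facts; no fact is proved here beyond
the six tree theorems it cites by name; no stub closes; 21420 ∕ 19111 stay OPEN; nothing about any curve's BSD; T7. BSD is proved for no curve.
References (locators only): [cite: Kato2004Asterisque, §12.2 (12.2.1) (p. 220)] [cite: Darmon2004, Thm. 3.6 and Thm. 3.7 (PDF pp. 43–44)]
[cite: BarriosEtAl2025, Thm. 5.1 (arXiv:2501.03209 pp. 15–16)] [cite: MilneADT2006, Ch. I, Thm. 2.6, Thm. 4.10(b), Cor. 2.3]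
[cite: Howard2004HeegnerKolyvagin, Thm. 2.1.11 (arXiv:1202.6340 p. 6)] [cite: CasselsFrohlichANT1967, Ch. VII §11].
-/

set_option linter.dupNamespace false
set_option autoImplicit false

namespace Summit.BirchSwinnertonDyer.BirchSwinnertonDyer.Theorems.CornerInertR12

open scoped Classical NumberField
open CongruenceSubgroup WeierstrassCurve NumberField IsDedekindDomain Literature.NumberTheory.EllipticCurves
  Literature.NumberTheory.EllipticCurves.ModularForms Literature.NumberTheory.GaloisCohomology
  Literature.NumberTheory.EllipticCurves.Rank1Residual Literature.NumberTheory.EllipticCurves.Rank1Residual.Typed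
  Literature.NumberTheory.EllipticCurves.BarriosEtAl2025 Literature.NumberTheory.Automorphic
  Summit.BirchSwinnertonDyer.Rank1Residual
  Summit.BirchSwinnertonDyer.Rank1Residual.X11b Summit.BirchSwinnertonDyer.Rank1Residual.X11b.Three
  Summit.BirchSwinnertonDyer.BirchSwinnertonDyer.Theorems

/-- **r11's `stub_upper3_monoNamedFacts` (REGISTERED text, three conjuncts) FROM r12's (two conjuncts)**: the middle conjunct — Howard's
complement property of THE canonical invariant maps at every number field and level — is the tree theorem
`SchneiderFreeAdditiveX3.PoitouTateReduction.selmerComplement_canonical_holds` (p626891).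
[cite: Howard2004HeegnerKolyvagin, Thm. 2.1.11 (arXiv:1202.6340 p. 6)] [cite: MilneADT2006, Ch. I, Thm. 4.10(b)] -/
theorem monoNamedFacts_r11_of_r12
    (h :
      Literature.NumberTheory.EllipticCurves.GrossLMS1991.prop37_2_frobeniusCongruence ∧
      Literature.NumberTheory.EllipticCurves.Gross1991_heegnerPoint_sub_ratTorsion_mem_E0_imageFree) :
    Literature.NumberTheory.EllipticCurves.GrossLMS1991.prop37_2_frobeniusCongruence ∧
    (∀ (K : Type) [Field K] [NumberField K] (n : ℕ) [NeZero n],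
    (Literature.NumberTheory.GaloisCohomology.LocalInvariants.canonical K n).SelmerComplement) ∧
    Literature.NumberTheory.EllipticCurves.Gross1991_heegnerPoint_sub_ratTorsion_mem_E0_imageFree :=
  ⟨h.1, fun K _ _ n _ ↦ SchneiderFreeAdditiveX3.PoitouTateReduction.selmerComplement_canonical_holds K n, h.2⟩

/-- **r12's `stub_upper3_monoNamedFacts` FROM r11's** (projection; r12 asks for LESS). [cite: GrossLMS1991, Prop. 3.7 (2) (p. 240)] -/
theorem monoNamedFacts_r12_of_r11
    (h :
      Literature.NumberTheory.EllipticCurves.GrossLMS1991.prop37_2_frobeniusCongruence ∧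
      (∀ (K : Type) [Field K] [NumberField K] (n : ℕ) [NeZero n],
      (Literature.NumberTheory.GaloisCohomology.LocalInvariants.canonical K n).SelmerComplement) ∧
      Literature.NumberTheory.EllipticCurves.Gross1991_heegnerPoint_sub_ratTorsion_mem_E0_imageFree) :
    Literature.NumberTheory.EllipticCurves.GrossLMS1991.prop37_2_frobeniusCongruence ∧
    Literature.NumberTheory.EllipticCurves.Gross1991_heegnerPoint_sub_ratTorsion_mem_E0_imageFree :=
  ⟨h.1, h.2.2⟩

/-- **r11's `stub_cornerFacts3` (REGISTERED text, twenty-seven named facts) FROM r12's (twenty-two)**: the five removed conjuncts are supplied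
by the tree theorems `Kato2004.nonempty_iwasawaH1Data_holds` (through mult-p3 g5's `CornerFactsDischarged.katoTwinFactsThreeAn_of_twelve`),
`heegnerPointOfConductor_one_galoisConj_holds`, `phi_heegnerTau_mem_singularModuliField_holds`,
`SchneiderFreeAdditiveX3.PoitouTateReduction.poitouTate_selmerStructure_duality_holds` (p624636) and
`BarriosEtAl2025.localTamagawaNumber_quadraticTwist_two_mem_of_goodReduction_holds`.
[cite: Kato2004Asterisque, §12.2 (12.2.1) (p. 220)] [cite: Darmon2004, Thm. 3.6 and Thm. 3.7 (PDF pp. 43–44)]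
[cite: BarriosEtAl2025, Thm. 5.1 (arXiv:2501.03209 pp. 15–16)] [cite: MilneADT2006, Ch. I, Thm. 4.10(b), Cor. 2.3, Thm. 2.6] -/
theorem cornerFacts3_r11_of_r12
    (h :
      (Literature.NumberTheory.EllipticCurves.SteinWuthrich2013.thm61_splitMultiplicative ∧
      Literature.NumberTheory.EllipticCurves.SteinWuthrich2013.thm61_nonsplitMultiplicative ∧
      Literature.NumberTheory.EllipticCurves.rank_eq_analyticRank_of_analyticRank_le_one ∧
      WeierstrassCurve.hasEntireLFunction_rat ∧
      Literature.NumberTheory.EllipticCurves.ModularForms.nonempty_modularParametrizationData ∧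
      (∀ (W : WeierstrassCurve ℚ) [W.IsElliptic] [W.IsGloballyMinimal] (p : ℕ) [Fact p.Prime],
      Literature.NumberTheory.EllipticCurves.greenberg_stevens W p) ∧
      Literature.NumberTheory.EllipticCurves.Kato2004.thm12_4 ∧
      Literature.NumberTheory.EllipticCurves.Kato2004.exists_multDivisibilityInputs_nonsplit ∧
      Literature.NumberTheory.EllipticCurves.Kato2004.exists_multDivisibilityInputs_split ∧
      Literature.NumberTheory.EllipticCurves.Greenberg1999.thm15_isTorsion_multiplicative_rat ∧
      Literature.NumberTheory.EllipticCurves.Wuthrich2014.corollary18_padicLFunction_mem_iwasawaAlgebra_multiplicative ∧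
      Literature.NumberTheory.EllipticCurves.Kato2004.exists_multDivisibilityInputs_fine) ∧
      (∀ (N : ℕ) [NeZero N] (W : WeierstrassCurve ℚ) (K : Type) [Field K] [NumberField K], kolyvagin N W K) ∧
      exists_isNewformOf ∧
      (∀ (K : Type) [Field K] [NumberField K], poitouTate_sha_tateDual K) ∧
      (∀ (N : ℕ) [NeZero N] (W : WeierstrassCurve ℚ) (K : Type) [Field K] [NumberField K], gross_zagier N W K) ∧
      HoffsteinLuo1997_exists_twist_L_one_ne_zero ∧
      mazur_not_dvd_maninConstant_of_odd ∧
      friedbergHoffstein_exists_twist_ne_zero_inertAt ∧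
      nonempty_shimuraParametrizationData ∧
      PastenShimura2024_componentOrders ∧
      shimuraCurve_heegnerPoint_grossZagier) :
    (Literature.NumberTheory.EllipticCurves.SteinWuthrich2013.thm61_splitMultiplicative ∧
    Literature.NumberTheory.EllipticCurves.SteinWuthrich2013.thm61_nonsplitMultiplicative ∧
    Literature.NumberTheory.EllipticCurves.rank_eq_analyticRank_of_analyticRank_le_one ∧
    WeierstrassCurve.hasEntireLFunction_rat ∧
    Literature.NumberTheory.EllipticCurves.ModularForms.nonempty_modularParametrizationData ∧
    (∀ (W : WeierstrassCurve ℚ) [W.IsElliptic] [W.IsGloballyMinimal] (p : ℕ) [Fact p.Prime],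
    Literature.NumberTheory.EllipticCurves.greenberg_stevens W p) ∧
    Literature.NumberTheory.EllipticCurves.Kato2004.nonempty_iwasawaH1Data ∧
    Literature.NumberTheory.EllipticCurves.Kato2004.thm12_4 ∧
    Literature.NumberTheory.EllipticCurves.Kato2004.exists_multDivisibilityInputs_nonsplit ∧
    Literature.NumberTheory.EllipticCurves.Kato2004.exists_multDivisibilityInputs_split ∧
    Literature.NumberTheory.EllipticCurves.Greenberg1999.thm15_isTorsion_multiplicative_rat ∧
    Literature.NumberTheory.EllipticCurves.Wuthrich2014.corollary18_padicLFunction_mem_iwasawaAlgebra_multiplicative ∧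
    Literature.NumberTheory.EllipticCurves.Kato2004.exists_multDivisibilityInputs_fine) ∧
    (∀ (N : ℕ) [NeZero N] (W : WeierstrassCurve ℚ) (K : Type) [Field K] [NumberField K], kolyvagin N W K) ∧
    (∀ (N : ℕ) [NeZero N] (W : WeierstrassCurve ℚ) (K : Type) [Field K] [NumberField K],
    heegnerPointOfConductor_one_galoisConj N W K) ∧
    (∀ (N : ℕ) [NeZero N] (W : WeierstrassCurve ℚ) (K : Type) [Field K] [NumberField K],
    phi_heegnerTau_mem_singularModuliField N W K) ∧
    exists_isNewformOf ∧
    (∀ (K : Type) [Field K] [NumberField K], poitouTate_selmerStructure_duality K) ∧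
    (∀ (K : Type) [Field K] [NumberField K], poitouTate_sha_tateDual K) ∧
    (∀ (N : ℕ) [NeZero N] (W : WeierstrassCurve ℚ) (K : Type) [Field K] [NumberField K], gross_zagier N W K) ∧
    HoffsteinLuo1997_exists_twist_L_one_ne_zero ∧
    mazur_not_dvd_maninConstant_of_odd ∧
    friedbergHoffstein_exists_twist_ne_zero_inertAt ∧
    localTamagawaNumber_quadraticTwist_two_mem_of_goodReduction ∧
    nonempty_shimuraParametrizationData ∧
    PastenShimura2024_componentOrders ∧
    shimuraCurve_heegnerPoint_grossZagier := by
  obtain ⟨⟨hJs, hJn, hGZK, hmod, hpar, hGS, h12, hns, hsp, h15, h18, hfine⟩, hKo, hnf, hPT2, hGZ, hHL, hMaz, hFH, hJL, hPS,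
    hCST⟩ := h
  exact ⟨CornerFactsDischarged.katoTwinFactsThreeAn_of_twelve hJs hJn hGZK hmod hpar hGS h12 hns hsp h15 h18 hfine, hKo,
    fun N _ W K _ _ ↦ heegnerPointOfConductor_one_galoisConj_holds N W K,
    fun N _ W K _ _ ↦ phi_heegnerTau_mem_singularModuliField_holds N W K, hnf,
    fun K _ _ ↦ SchneiderFreeAdditiveX3.PoitouTateReduction.poitouTate_selmerStructure_duality_holds K, hPT2, hGZ, hHL, hMaz,
    hFH, BarriosEtAl2025.localTamagawaNumber_quadraticTwist_two_mem_of_goodReduction_holds, hJL, hPS, hCST⟩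

/-- **r12's `stub_cornerFacts3` FROM r11's** (projection; r12 asks for LESS). [cite: Kato2004Asterisque, Thm. 12.4, §17.13] -/
theorem cornerFacts3_r12_of_r11
    (h :
      (Literature.NumberTheory.EllipticCurves.SteinWuthrich2013.thm61_splitMultiplicative ∧
      Literature.NumberTheory.EllipticCurves.SteinWuthrich2013.thm61_nonsplitMultiplicative ∧
      Literature.NumberTheory.EllipticCurves.rank_eq_analyticRank_of_analyticRank_le_one ∧
      WeierstrassCurve.hasEntireLFunction_rat ∧
      Literature.NumberTheory.EllipticCurves.ModularForms.nonempty_modularParametrizationData ∧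
      (∀ (W : WeierstrassCurve ℚ) [W.IsElliptic] [W.IsGloballyMinimal] (p : ℕ) [Fact p.Prime],
      Literature.NumberTheory.EllipticCurves.greenberg_stevens W p) ∧
      Literature.NumberTheory.EllipticCurves.Kato2004.nonempty_iwasawaH1Data ∧
      Literature.NumberTheory.EllipticCurves.Kato2004.thm12_4 ∧
      Literature.NumberTheory.EllipticCurves.Kato2004.exists_multDivisibilityInputs_nonsplit ∧
      Literature.NumberTheory.EllipticCurves.Kato2004.exists_multDivisibilityInputs_split ∧
      Literature.NumberTheory.EllipticCurves.Greenberg1999.thm15_isTorsion_multiplicative_rat ∧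
      Literature.NumberTheory.EllipticCurves.Wuthrich2014.corollary18_padicLFunction_mem_iwasawaAlgebra_multiplicative ∧
      Literature.NumberTheory.EllipticCurves.Kato2004.exists_multDivisibilityInputs_fine) ∧
      (∀ (N : ℕ) [NeZero N] (W : WeierstrassCurve ℚ) (K : Type) [Field K] [NumberField K], kolyvagin N W K) ∧
      (∀ (N : ℕ) [NeZero N] (W : WeierstrassCurve ℚ) (K : Type) [Field K] [NumberField K],
      heegnerPointOfConductor_one_galoisConj N W K) ∧
      (∀ (N : ℕ) [NeZero N] (W : WeierstrassCurve ℚ) (K : Type) [Field K] [NumberField K],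
      phi_heegnerTau_mem_singularModuliField N W K) ∧
      exists_isNewformOf ∧
      (∀ (K : Type) [Field K] [NumberField K], poitouTate_selmerStructure_duality K) ∧
      (∀ (K : Type) [Field K] [NumberField K], poitouTate_sha_tateDual K) ∧
      (∀ (N : ℕ) [NeZero N] (W : WeierstrassCurve ℚ) (K : Type) [Field K] [NumberField K], gross_zagier N W K) ∧
      HoffsteinLuo1997_exists_twist_L_one_ne_zero ∧
      mazur_not_dvd_maninConstant_of_odd ∧
      friedbergHoffstein_exists_twist_ne_zero_inertAt ∧
      localTamagawaNumber_quadraticTwist_two_mem_of_goodReduction ∧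
      nonempty_shimuraParametrizationData ∧
      PastenShimura2024_componentOrders ∧
      shimuraCurve_heegnerPoint_grossZagier) :
    (Literature.NumberTheory.EllipticCurves.SteinWuthrich2013.thm61_splitMultiplicative ∧
    Literature.NumberTheory.EllipticCurves.SteinWuthrich2013.thm61_nonsplitMultiplicative ∧
    Literature.NumberTheory.EllipticCurves.rank_eq_analyticRank_of_analyticRank_le_one ∧
    WeierstrassCurve.hasEntireLFunction_rat ∧
    Literature.NumberTheory.EllipticCurves.ModularForms.nonempty_modularParametrizationData ∧
    (∀ (W : WeierstrassCurve ℚ) [W.IsElliptic] [W.IsGloballyMinimal] (p : ℕ) [Fact p.Prime],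
    Literature.NumberTheory.EllipticCurves.greenberg_stevens W p) ∧
    Literature.NumberTheory.EllipticCurves.Kato2004.thm12_4 ∧
    Literature.NumberTheory.EllipticCurves.Kato2004.exists_multDivisibilityInputs_nonsplit ∧
    Literature.NumberTheory.EllipticCurves.Kato2004.exists_multDivisibilityInputs_split ∧
    Literature.NumberTheory.EllipticCurves.Greenberg1999.thm15_isTorsion_multiplicative_rat ∧
    Literature.NumberTheory.EllipticCurves.Wuthrich2014.corollary18_padicLFunction_mem_iwasawaAlgebra_multiplicative ∧
    Literature.NumberTheory.EllipticCurves.Kato2004.exists_multDivisibilityInputs_fine) ∧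
    (∀ (N : ℕ) [NeZero N] (W : WeierstrassCurve ℚ) (K : Type) [Field K] [NumberField K], kolyvagin N W K) ∧
    exists_isNewformOf ∧
    (∀ (K : Type) [Field K] [NumberField K], poitouTate_sha_tateDual K) ∧
    (∀ (N : ℕ) [NeZero N] (W : WeierstrassCurve ℚ) (K : Type) [Field K] [NumberField K], gross_zagier N W K) ∧
    HoffsteinLuo1997_exists_twist_L_one_ne_zero ∧
    mazur_not_dvd_maninConstant_of_odd ∧
    friedbergHoffstein_exists_twist_ne_zero_inertAt ∧
    nonempty_shimuraParametrizationData ∧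
    PastenShimura2024_componentOrders ∧
    shimuraCurve_heegnerPoint_grossZagier := by
  obtain ⟨⟨hJs, hJn, hGZK, hmod, hpar, hGS, -, h12, hns, hsp, h15, h18, hfine⟩, hKo, -, -, hnf, -, hPT2, hGZ, hHL, hMaz, hFH,
    -, hJL, hPS, hCST⟩ := h
  exact ⟨⟨hJs, hJn, hGZK, hmod, hpar, hGS, h12, hns, hsp, h15, h18, hfine⟩, hKo, hnf, hPT2, hGZ, hHL, hMaz, hFH, hJL, hPS, hCST⟩

end Summit.BirchSwinnertonDyer.BirchSwinnertonDyer.Theorems.CornerInertR12
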